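import Summits.Ventures.HodgeRepro2.T5SU11WeightedSpaceGroundState

/-!
# The resolvent is differentiable in the spectral parameter on `W_1`: `d/dμ (L − μ)⁻¹ = (L − μ)⁻²`

On the ground-state weighted space `W_1 = {|g| ≤ D Ξ}` row 557's Lipschitz bound
`|G^I_λ g(t) − G^I_{λ₂} g(t)| ≤ |μ − μ₂| D Ξ(t)/((λ − 1)² (λ₂ − 1)²)` and row 500's resolvent identity
`G^I_λ g − G^I_{λ₂} g = (μ − μ₂) G^I_λ(G^I_{λ₂} g)` give, at every `t > 0`:

* `tendsto_greenSolI_lam` — **`λ ↦ G^I_λ g(t)` is continuous at every `λ₂ > 1`**;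
* `hasDerivAt_greenSolI_lam` — **`λ ↦ G^I_λ g(t)` is differentiable at `λ₂` with derivative
  `(2λ₂ − 2) · G^I_{λ₂}(G^I_{λ₂} g)(t)`** — since `dμ/dλ = 2λ − 2`, this is `d/dμ (L − μ)⁻¹ g = (L − μ)⁻² g`, the classical
  derivative of the resolvent;
* `deriv_greenSolI_lam` — the same as an equation for `deriv`.

Nothing is claimed about (N).

Blind lane: Mathlib + the HodgeRepro2 prefix only; no sorry; axioms ⊆ {propext, Classical.choice,
Quot.sound}.
-/

namespace Summit.Ventures.HodgeRepro2.T5SU11ResolventDerivativeGroundState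

open Filter Topology MeasureTheory
open Set (Ioi Ioc)
open T5SU11Cartan T5SU11SphericalFunction T5SU11SphericalDecay T5SU11RadialGreenImproper
  T5SU11ResolventIdentityDecay T5SU11ResolventGroundStateWeight T5SU11WeightedSpaceGroundState

section measure

variable [MeasurableSpace Circle] [BorelSpace Circle]

variable {lam₂ : ℝ} (hlam₂ : 1 < lam₂) {g : ℝ → ℝ} (hg : ContinuousOn g (Ioi 0))
  {D : ℝ} (hD : ∀ s, 0 < s → |g s| ≤ D * sph 1 (hyp s))

include hlam₂ hg hD in
/-- **The resolvent is continuous in the spectral parameter on `W_1`**: `λ ↦ G^I_λ g(t)` is continuous at every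
`λ₂ > 1` (`t > 0`). -/
theorem tendsto_greenSolI_lam {t : ℝ} (ht : 0 < t) :
    Tendsto (fun l => greenSolI (fun t => sph l (hyp t)) (sphDecay l) g t) (𝓝 lam₂)
      (𝓝 (greenSolI (fun t => sph lam₂ (hyp t)) (sphDecay lam₂) g t)) := by
  rw [tendsto_iff_norm_sub_tendsto_zero]
  have hp : 0 < (lam₂ - 1) ^ 2 := by
    have : 0 < lam₂ - 1 := by linarith
    positivity
  -- the bound `|μ(l) − μ₂| D Ξ(t)/((l − 1)² (λ₂ − 1)²)` is continuous at `λ₂` and vanishes there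
  have hc : ContinuousAt (fun l : ℝ => |l * (l - 2) - lam₂ * (lam₂ - 2)| * D * sph 1 (hyp t)
      / ((l - 1) ^ 2 * (lam₂ - 1) ^ 2)) lam₂ := by
    apply ContinuousAt.div
    · exact ((((continuousAt_id.mul (continuousAt_id.sub continuousAt_const)).sub continuousAt_const).abs.mul
        continuousAt_const).mul continuousAt_const)
    · exact ((continuousAt_id.sub continuousAt_const).pow 2).mul continuousAt_const
    · positivity
  have hbound : Tendsto (fun l : ℝ => |l * (l - 2) - lam₂ * (lam₂ - 2)| * D * sph 1 (hyp t)
      / ((l - 1) ^ 2 * (lam₂ - 1) ^ 2)) (𝓝 lam₂) (𝓝 0) := by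
    have h := hc.tendsto
    simpa only [sub_self, abs_zero, zero_mul, zero_div] using h
  refine squeeze_zero_norm' ?_ hbound
  filter_upwards [eventually_gt_nhds hlam₂] with l hl
  simp only [Real.norm_eq_abs, abs_abs]
  exact abs_greenSolI_sub_le_mul_sph_one hl hg hD hlam₂ ht

include hlam₂ hg hD in
/-- **THE DERIVATIVE OF THE RESOLVENT ON `W_1`**: `λ ↦ G^I_λ g(t)` has derivative `(2λ₂ − 2) · G^I_{λ₂}(G^I_{λ₂} g)(t)` at
`λ₂ > 1` — i.e. `d/dμ (L − μ)⁻¹ g = (L − μ)⁻² g` (`dμ/dλ = 2λ − 2`). -/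
theorem hasDerivAt_greenSolI_lam {t : ℝ} (ht : 0 < t) :
    HasDerivAt (fun l => greenSolI (fun t => sph l (hyp t)) (sphDecay l) g t)
      ((2 * lam₂ - 2) * greenSolI (fun t => sph lam₂ (hyp t)) (sphDecay lam₂)
        (greenSolI (fun t => sph lam₂ (hyp t)) (sphDecay lam₂) g) t) lam₂ := by
  rw [hasDerivAt_iff_tendsto_slope]
  set h := greenSolI (fun t => sph lam₂ (hyp t)) (sphDecay lam₂) g with hh
  -- `h = G^I_{λ₂} g ∈ W_1` (row 556), so `l ↦ G^I_l h(t)` is continuous at `λ₂`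
  obtain ⟨hcont, hbound⟩ := greenSolI_mem_weighted_one hlam₂ hg hD
  have hlim : Tendsto (fun l => (l + lam₂ - 2) * greenSolI (fun t => sph l (hyp t)) (sphDecay l) h t) (𝓝 lam₂)
      (𝓝 ((2 * lam₂ - 2) * greenSolI (fun t => sph lam₂ (hyp t)) (sphDecay lam₂) h t)) := by
    have h1 : Tendsto (fun l : ℝ => l + lam₂ - 2) (𝓝 lam₂) (𝓝 (lam₂ + lam₂ - 2)) :=
      ((continuous_id.add continuous_const).sub continuous_const).tendsto lam₂
    have h2 := tendsto_greenSolI_lam hlam₂ hcont hbound ht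
    have h12 := h1.mul h2
    rwa [show lam₂ + lam₂ - 2 = 2 * lam₂ - 2 by ring] at h12
  refine (tendsto_nhdsWithin_of_tendsto_nhds hlim).congr' ?_
  -- on `𝓝[≠] λ₂`, eventually `l > 1`, and the slope is `(l + λ₂ − 2) G^I_l h(t)` by the resolvent identity
  have hev : ∀ᶠ l in 𝓝[≠] lam₂, 1 < l := eventually_nhdsWithin_of_eventually_nhds (eventually_gt_nhds hlam₂)
  filter_upwards [hev, self_mem_nhdsWithin] with l hl hne
  have hne' : l - lam₂ ≠ 0 := sub_ne_zero.mpr (Set.mem_compl_singleton_iff.mp hne)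
  simp only [slope_def_field]
  have hmin : 1 < min l lam₂ := lt_min hl hlam₂
  obtain ⟨hM, hD0, hε, C, hC⟩ := class_of_le_mul_sph_one hmin hD
  have hε₁ : 2 - l < (3 - min l lam₂) / 2 := by linarith [min_le_left l lam₂]
  have hε₂ : 2 - lam₂ < (3 - min l lam₂) / 2 := by linarith [min_le_right l lam₂]
  rw [greenSolI_sub_greenSolI_eq hl hlam₂ hg hM hD0 hε₁ hε₂ hC ht, ← hh]
  have e : l * (l - 2) - lam₂ * (lam₂ - 2) = (l - lam₂) * (l + lam₂ - 2) := by ring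
  rw [e]
  field_simp

include hlam₂ hg hD in
/-- **`deriv (λ ↦ G^I_λ g(t)) λ₂ = (2λ₂ − 2) · G^I_{λ₂}(G^I_{λ₂} g)(t)`** on `W_1`. -/
theorem deriv_greenSolI_lam {t : ℝ} (ht : 0 < t) :
    deriv (fun l => greenSolI (fun t => sph l (hyp t)) (sphDecay l) g t) lam₂
      = (2 * lam₂ - 2) * greenSolI (fun t => sph lam₂ (hyp t)) (sphDecay lam₂)
        (greenSolI (fun t => sph lam₂ (hyp t)) (sphDecay lam₂) g) t :=
  (hasDerivAt_greenSolI_lam hlam₂ hg hD ht).deriv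

end measure

end Summit.Ventures.HodgeRepro2.T5SU11ResolventDerivativeGroundState
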